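import Summits.Ventures.CertifiedArithmetic.LowPrec.SRRecursionLimitedBitsMSE
import Summits.Ventures.CertifiedArithmetic.LowPrec.SRCertificatesFP4
import HarnessLib

/-!
# Horner and FMA-Horner polynomial evaluation under (limited-randomness) stochastic rounding

HONEST FRAMING: certified error envelopes and provably optimal rounding/accumulation schemes for
low-precision formats under stated cost models; every table by two implementations; no hardware or
vendor claims.

Horner's rule `x ← round(x·t)`, `x ← round(x + c_j)` (`2n` roundings) and its FMA form
`x ← round(x·t + c_j)` (`n` roundings), evaluating `P(t) = s·tⁿ + ∑_{j<n} c_j t^{n−1−j}` from the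
leading coefficient `s`, are AFFINE RECURSIONS (files XLVI–XLVII, LXXIII–LXXIV): gains
`hornerA t = (t, 1, t, 1, …)` / constant `t`, offsets `hornerB c = (0, c₀, 0, c₁, …)` / `c`. This file
computes their exact trajectory and gain norms and reads off, for SR into ANY finite value set `F` with
ANY admissible limited-randomness rule `q` (`q([0,1]) ⊆ [0,1]`, `|q θ − θ| ≤ ε`; exact SR `ε = 0`,
`SR_ε`, P3109 StochasticA `ε = 2^{-N}`, B/C `ε = 2^{-(N+1)}`), no branch saturating, gaps `≤ G`:

1. `affMean_horner`, `affMean_fma`: the exact trajectory ends at `P(t)` (`hornerVal`); hence under exact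
   SR `E[P̂] = P(t)` for both schemes (`recExp_horner_mean`, `recExp_fma_mean`) — the finite-format
   counterpart of the first-order unbiasedness in [ElararEtAl2025].
2. Gain norms in closed form: Horner `∑|A| = 2·∑_{i<n}|t|ⁱ`, `∑A² = 2·∑_{i<n} t²ⁱ`
   (`absGainSum_horner`, `sqGainSum_horner`); FMA exactly HALF of each (`absGainSum_const`,
   `sqGainSum_const`).
3. Envelopes (files LXXIII–LXXIV specialised): bias `|E_q P̂ − P(t)| ≤ 2(∑|t|ⁱ)·εG` (Horner) /
   `(∑|t|ⁱ)·εG` (FMA); exact-SR variance `≤ 2(∑t²ⁱ)·G²/4` / `(∑t²ⁱ)·G²/4`; RMS triangle law over `ℝ`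
   `RMS ≤ √(2∑t²ⁱ)·G/2 + 2(∑|t|ⁱ)·εG` (Horner). For `|t| ≤ 1`: bias `≤ 2nεG` / `nεG`
   (`horner_bias_le_of_abs_le_one`, `fma_bias_le_of_abs_le_one`).
4. **FP4 (E2M1) kernel witnesses** (`decide`), `t = 3/4`, `s = 2`, `(c₀, c₁) = (3/2, −1/2)`, `P(t) = 7/4`:
   exact SR: both schemes have mean `7/4`; Horner MSE `1/4`, FMA MSE `1/16`; ONE random bit: Horner is
   biased `−1/4` (StochasticA), `+1/4` (B), `−1/4` (C) while FMA stays unbiased (its only inexact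
   pre-rounding value `7/4` has dyadic residual `1/2`) — two-implementation tables `certs/sr/gen15/`.

Placement. [ElararEtAl2025] (arXiv:2603.24161), Thm. 1 and Remark 3: under `SR_{p,r}` with the `(1+δ)`
model, Horner satisfies a probabilistic bound with constant `√(2n)·u·λ + 2n·2^{-r}u`-type terms (FMA: `n`);
here the same `2n` versus `n` appears as exact ℓ¹/ℓ² GAIN NORMS of a finite-format recursion, valid for
saturation-free windows of any value set, with the conditions under which the textbook picture breaks made
explicit (`NoSatR`; few-bit dead bands: file LXXVI).
-/

namespace Summit.Ventures.CertifiedArithmetic.LowPrec.SR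

open Literature.ComputerArithmetic.ConnollyHighamMary2021
open Finset

variable {K : Type*} [Field K] [LinearOrder K] [IsStrictOrderedRing K]

/-! ### Horner as an affine recursion -/

/-- Horner gains: even steps multiply by `t`, odd steps by `1`. -/
def hornerA (t : K) (k : ℕ) : K := if k % 2 = 0 then t else 1

/-- Horner offsets: even steps add `0`, step `2j+1` adds the coefficient `c j`. -/
def hornerB (c : ℕ → K) (k : ℕ) : K := if k % 2 = 0 then 0 else c (k / 2)

/-- The exact value of `n` Horner (or FMA) steps from `s`: `s·tⁿ + ∑_{j<n} c j · t^{n−1−j}`. -/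
def hornerVal (t : K) (c : ℕ → K) (n : ℕ) (s : K) : K :=
  s * t ^ n + ∑ j ∈ range n, c j * t ^ (n - 1 - j)

omit [LinearOrder K] [IsStrictOrderedRing K] in
/-- The first Horner gain is the multiplication by `t`. -/
@[simp] theorem hornerA_zero (t : K) : hornerA t 0 = t := by simp [hornerA]

omit [LinearOrder K] [IsStrictOrderedRing K] in
/-- The second Horner gain is `1` (the coefficient addition). -/
@[simp] theorem hornerA_one (t : K) : hornerA t 1 = 1 := by simp [hornerA]

omit [LinearOrder K] [IsStrictOrderedRing K] in
/-- The multiplication step adds nothing. -/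
@[simp] theorem hornerB_zero (c : ℕ → K) : hornerB c 0 = 0 := by simp [hornerB]

omit [LinearOrder K] [IsStrictOrderedRing K] in
/-- The addition step adds the leading remaining coefficient `c 0`. -/
@[simp] theorem hornerB_one (c : ℕ → K) : hornerB c 1 = c 0 := by simp [hornerB]

omit [LinearOrder K] [IsStrictOrderedRing K] in
/-- The gain pattern has period two. -/
theorem hornerA_shift2 (t : K) : (fun i => hornerA t (i + 1 + 1)) = hornerA t := by
  funext i
  show (if (i + 2) % 2 = 0 then t else 1) = if i % 2 = 0 then t else 1
  rw [Nat.add_mod_right]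

omit [LinearOrder K] [IsStrictOrderedRing K] in
/-- Shifting the offsets by two steps shifts the coefficients by one. -/
theorem hornerB_shift2 (c : ℕ → K) : (fun i => hornerB c (i + 1 + 1)) = hornerB (fun j => c (j + 1)) := by
  funext i
  show (if (i + 2) % 2 = 0 then 0 else c ((i + 2) / 2)) = if i % 2 = 0 then 0 else c (i / 2 + 1)
  rw [Nat.add_mod_right, Nat.add_div_right i two_pos]

omit [LinearOrder K] [IsStrictOrderedRing K] in
/-- One Horner / FMA step peeled off the front: `P = hornerVal t c↑ n (t·s + c₀)`. -/
theorem hornerVal_succ (t : K) (c : ℕ → K) (n : ℕ) (s : K) :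
    hornerVal t c (n + 1) s = hornerVal t (fun j => c (j + 1)) n (t * s + c 0) := by
  simp only [hornerVal]
  rw [Finset.sum_range_succ' (fun j => c j * t ^ (n + 1 - 1 - j))]
  have : ∀ j ∈ range n, c (j + 1) * t ^ (n + 1 - 1 - (j + 1)) = c (j + 1) * t ^ (n - 1 - j) := by
    intro j _; rw [show n + 1 - 1 - (j + 1) = n - 1 - j from by omega]
  rw [Finset.sum_congr rfl this, show n + 1 - 1 - 0 = n from by omega]
  ring

omit [LinearOrder K] [IsStrictOrderedRing K] in
/-- **Horner's exact trajectory ends at `P(t)`.** -/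
theorem affMean_horner (t : K) (c : ℕ → K) (n : ℕ) (s : K) :
    affMean (hornerA t) (hornerB c) (2 * n) s = hornerVal t c n s := by
  induction n generalizing c s with
  | zero => simp [affMean, hornerVal]
  | succ n ih =>
    rw [show 2 * (n + 1) = 2 * n + 1 + 1 by ring, hornerVal_succ]
    simp only [affMean]
    rw [hornerA_shift2, hornerB_shift2, ih]
    simp

omit [LinearOrder K] [IsStrictOrderedRing K] in
/-- **FMA-Horner's exact trajectory ends at `P(t)`** (`n` steps `x ← x·t + c_j`). -/
theorem affMean_fma (t : K) (c : ℕ → K) (n : ℕ) (s : K) :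
    affMean (fun _ => t) c n s = hornerVal t c n s := by
  induction n generalizing c s with
  | zero => simp [affMean, hornerVal]
  | succ n ih => rw [hornerVal_succ]; simp only [affMean]; exact ih _ _

/-! ### Gain norms in closed form -/

omit [LinearOrder K] [IsStrictOrderedRing K] in
/-- Downstream gain of `2n` Horner steps: `tⁿ`. -/
theorem affGain_horner (t : K) (n : ℕ) : affGain (hornerA t) (2 * n) = t ^ n := by
  induction n with
  | zero => simp [affGain]
  | succ n ih =>
    rw [show 2 * (n + 1) = 2 * n + 1 + 1 by ring]
    simp only [affGain]
    rw [hornerA_shift2, ih]; simp [pow_succ]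

omit [LinearOrder K] [IsStrictOrderedRing K] in
/-- Constant gain `t` (FMA-Horner, decay chains): `Aₙ = tⁿ`. -/
theorem affGain_const (t : K) (n : ℕ) : affGain (fun _ => t) n = t ^ n := by
  induction n with
  | zero => simp [affGain]
  | succ n ih => simp only [affGain] at *; rw [ih, pow_succ]

omit [LinearOrder K] [IsStrictOrderedRing K] in
/-- **Horner's ℓ² gain norm**: `∑ A_{k+1}² = 2·∑_{i<n} (t²)ⁱ` — every power is counted TWICE (once for the
multiplication's rounding, once for the addition's). -/
theorem sqGainSum_horner (t : K) (n : ℕ) :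
    sqGainSum (hornerA t) (2 * n) = 2 * ∑ i ∈ range n, (t ^ 2) ^ i := by
  induction n with
  | zero => simp [sqGainSum]
  | succ n ih =>
    rw [show 2 * (n + 1) = 2 * n + 1 + 1 by ring]
    simp only [sqGainSum, affGain]
    rw [hornerA_shift2, affGain_horner, ih, Finset.sum_range_succ]
    simp; ring

omit [LinearOrder K] [IsStrictOrderedRing K] in
/-- FMA-Horner's ℓ² gain norm: `∑_{i<n} (t²)ⁱ` — half of Horner's. -/
theorem sqGainSum_const (t : K) (n : ℕ) : sqGainSum (fun _ => t) n = ∑ i ∈ range n, (t ^ 2) ^ i := by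
  induction n with
  | zero => simp [sqGainSum]
  | succ n ih =>
    simp only [sqGainSum] at *
    rw [affGain_const, ih, Finset.sum_range_succ]; ring

/-- **Horner's ℓ¹ gain norm**: `∑ |A_{k+1}| = 2·∑_{i<n} |t|ⁱ`. -/
theorem absGainSum_horner (t : K) (n : ℕ) :
    LimitedBits.absGainSum (hornerA t) (2 * n) = 2 * ∑ i ∈ range n, |t| ^ i := by
  induction n with
  | zero => simp [LimitedBits.absGainSum]
  | succ n ih =>
    rw [show 2 * (n + 1) = 2 * n + 1 + 1 by ring]
    simp only [LimitedBits.absGainSum, affGain]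
    rw [hornerA_shift2, affGain_horner, ih, Finset.sum_range_succ]
    simp [abs_pow]; ring

/-- FMA-Horner's ℓ¹ gain norm: `∑_{i<n} |t|ⁱ` — half of Horner's. -/
theorem absGainSum_const (t : K) (n : ℕ) :
    LimitedBits.absGainSum (fun _ => t) n = ∑ i ∈ range n, |t| ^ i := by
  induction n with
  | zero => simp [LimitedBits.absGainSum]
  | succ n ih =>
    simp only [LimitedBits.absGainSum] at *
    rw [affGain_const, ih, Finset.sum_range_succ, abs_pow]; ring

/-- For `|t| ≤ 1` the geometric sums are at most `n`. -/
theorem geom_abs_le (n : ℕ) {t : K} (ht : |t| ≤ 1) : ∑ i ∈ range n, |t| ^ i ≤ n :=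
  (Finset.sum_le_sum fun i _ => pow_le_one₀ (abs_nonneg t) ht).trans (by simp)

/-- For `|t| ≤ 1`: `∑_{i<n} (t²)ⁱ ≤ n`. -/
theorem geom_sq_le (n : ℕ) {t : K} (ht : |t| ≤ 1) : ∑ i ∈ range n, (t ^ 2) ^ i ≤ n := by
  have ht2 : t ^ 2 ≤ 1 := by rw [← sq_abs]; exact pow_le_one₀ (abs_nonneg t) ht
  exact (Finset.sum_le_sum fun i _ => pow_le_one₀ (sq_nonneg t) ht2).trans (by simp)

/-! ### Exact SR: unbiased, variance by the ℓ² gain norm -/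

omit [IsStrictOrderedRing K] in
/-- **Horner under exact SR is unbiased**: `E[P̂] = P(t)` whenever no branch saturates. -/
theorem recExp_horner_mean (F : Finset K) (t : K) (c : ℕ → K) (n : ℕ) (s : K)
    (h : NoSatR F (affMap (hornerA t) (hornerB c)) (2 * n) s) :
    recExp F (affMap (hornerA t) (hornerB c)) (2 * n) (fun y => y) s = hornerVal t c n s := by
  rw [recExp_affMap_id_of_noSatR F _ _ _ s h, affMean_horner]

omit [IsStrictOrderedRing K] in
/-- **FMA-Horner under exact SR is unbiased.** -/
theorem recExp_fma_mean (F : Finset K) (t : K) (c : ℕ → K) (n : ℕ) (s : K)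
    (h : NoSatR F (affMap (fun _ => t) c) n s) :
    recExp F (affMap (fun _ => t) c) n (fun y => y) s = hornerVal t c n s := by
  rw [recExp_affMap_id_of_noSatR F _ _ _ s h, affMean_fma]

/-- **Horner's exact-SR variance**: `E(P̂ − P(t))² ≤ 2(∑_{i<n} t²ⁱ)·G²/4`. -/
theorem recExp_horner_var_le (F : Finset K) (G t : K) (c : ℕ → K) (n : ℕ) (s : K)
    (h : NoSatR F (affMap (hornerA t) (hornerB c)) (2 * n) s)
    (hgap : GapLER F G (affMap (hornerA t) (hornerB c)) (2 * n) s) :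
    recExp F (affMap (hornerA t) (hornerB c)) (2 * n) (fun y => (y - hornerVal t c n s) ^ 2) s
      ≤ (2 * ∑ i ∈ range n, (t ^ 2) ^ i) * (G ^ 2 / 4) := by
  rw [← affMean_horner, recExp_affMap_var F _ _ _ s h, ← sqGainSum_horner]
  exact recVar_le_window F G _ _ _ s hgap

/-- **FMA-Horner's exact-SR variance**: `E(P̂ − P(t))² ≤ (∑_{i<n} t²ⁱ)·G²/4` — half of Horner's budget. -/
theorem recExp_fma_var_le (F : Finset K) (G t : K) (c : ℕ → K) (n : ℕ) (s : K)
    (h : NoSatR F (affMap (fun _ => t) c) n s) (hgap : GapLER F G (affMap (fun _ => t) c) n s) :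
    recExp F (affMap (fun _ => t) c) n (fun y => (y - hornerVal t c n s) ^ 2) s
      ≤ (∑ i ∈ range n, (t ^ 2) ^ i) * (G ^ 2 / 4) := by
  rw [← affMean_fma, recExp_affMap_var F _ _ _ s h, ← sqGainSum_const]
  exact recVar_le_window F G _ _ _ s hgap

/-! ### Limited-randomness SR: bias by the ℓ¹ gain norm, RMS triangle law -/

namespace LimitedBits

/-- **Horner's bias under limited-randomness SR**: `|E_q P̂ − P(t)| ≤ 2(∑_{i<n}|t|ⁱ)·ε·G`. -/
theorem horner_bias_le (F : Finset K) {q : K → K} {ε G : K}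
    (hq01 : ∀ η, 0 ≤ η → η ≤ 1 → 0 ≤ q η ∧ q η ≤ 1) (hq : ∀ η, 0 ≤ η → η ≤ 1 → |q η - η| ≤ ε)
    (t : K) (c : ℕ → K) (n : ℕ) (s : K) (hns : NoSatR F (affMap (hornerA t) (hornerB c)) (2 * n) s)
    (hgap : GapLER F G (affMap (hornerA t) (hornerB c)) (2 * n) s) :
    |recExpQ F q (affMap (hornerA t) (hornerB c)) (2 * n) (fun y => y) s - hornerVal t c n s|
      ≤ (2 * ∑ i ∈ range n, |t| ^ i) * (ε * G) := by
  rw [← affMean_horner, ← absGainSum_horner]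
  exact abs_recExpQ_affMap_id_sub_le F hq01 hq _ _ _ s hns hgap

/-- **FMA-Horner's bias under limited-randomness SR**: `|E_q P̂ − P(t)| ≤ (∑_{i<n}|t|ⁱ)·ε·G` — half. -/
theorem fma_bias_le (F : Finset K) {q : K → K} {ε G : K}
    (hq01 : ∀ η, 0 ≤ η → η ≤ 1 → 0 ≤ q η ∧ q η ≤ 1) (hq : ∀ η, 0 ≤ η → η ≤ 1 → |q η - η| ≤ ε)
    (t : K) (c : ℕ → K) (n : ℕ) (s : K) (hns : NoSatR F (affMap (fun _ => t) c) n s)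
    (hgap : GapLER F G (affMap (fun _ => t) c) n s) :
    |recExpQ F q (affMap (fun _ => t) c) n (fun y => y) s - hornerVal t c n s|
      ≤ (∑ i ∈ range n, |t| ^ i) * (ε * G) := by
  rw [← affMean_fma, ← absGainSum_const]
  exact abs_recExpQ_affMap_id_sub_le F hq01 hq _ _ _ s hns hgap

/-- `|t| ≤ 1`: Horner's bias is at most `2n·ε·G`. -/
theorem horner_bias_le_of_abs_le_one (F : Finset K) {q : K → K} {ε G : K}
    (hq01 : ∀ η, 0 ≤ η → η ≤ 1 → 0 ≤ q η ∧ q η ≤ 1) (hq : ∀ η, 0 ≤ η → η ≤ 1 → |q η - η| ≤ ε)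
    (hG : 0 ≤ G) {t : K} (ht : |t| ≤ 1) (c : ℕ → K) (n : ℕ) (s : K)
    (hns : NoSatR F (affMap (hornerA t) (hornerB c)) (2 * n) s)
    (hgap : GapLER F G (affMap (hornerA t) (hornerB c)) (2 * n) s) :
    |recExpQ F q (affMap (hornerA t) (hornerB c)) (2 * n) (fun y => y) s - hornerVal t c n s|
      ≤ 2 * n * (ε * G) := by
  have hε : 0 ≤ ε := (abs_nonneg _).trans (hq 0 le_rfl zero_le_one)
  refine (horner_bias_le F hq01 hq t c n s hns hgap).trans ?_
  rw [mul_assoc, mul_assoc]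
  exact mul_le_mul_of_nonneg_left (mul_le_mul_of_nonneg_right (geom_abs_le n ht) (mul_nonneg hε hG))
    zero_le_two

/-- `|t| ≤ 1`: FMA-Horner's bias is at most `n·ε·G`. -/
theorem fma_bias_le_of_abs_le_one (F : Finset K) {q : K → K} {ε G : K}
    (hq01 : ∀ η, 0 ≤ η → η ≤ 1 → 0 ≤ q η ∧ q η ≤ 1) (hq : ∀ η, 0 ≤ η → η ≤ 1 → |q η - η| ≤ ε)
    (hG : 0 ≤ G) {t : K} (ht : |t| ≤ 1) (c : ℕ → K) (n : ℕ) (s : K)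
    (hns : NoSatR F (affMap (fun _ => t) c) n s) (hgap : GapLER F G (affMap (fun _ => t) c) n s) :
    |recExpQ F q (affMap (fun _ => t) c) n (fun y => y) s - hornerVal t c n s| ≤ n * (ε * G) := by
  have hε : 0 ≤ ε := (abs_nonneg _).trans (hq 0 le_rfl zero_le_one)
  exact (fma_bias_le F hq01 hq t c n s hns hgap).trans
    (mul_le_mul_of_nonneg_right (geom_abs_le n ht) (mul_nonneg hε hG))

/-- **Horner's mean square under limited-randomness SR** (Young family, every `r > 0`). -/
theorem horner_sq_le_general (F : Finset K) {q : K → K} {ε G : K}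
    (hq01 : ∀ η, 0 ≤ η → η ≤ 1 → 0 ≤ q η ∧ q η ≤ 1) (hq : ∀ η, 0 ≤ η → η ≤ 1 → |q η - η| ≤ ε)
    (t : K) (c : ℕ → K) (n : ℕ) (s : K) (hns : NoSatR F (affMap (hornerA t) (hornerB c)) (2 * n) s)
    (hgap : GapLER F G (affMap (hornerA t) (hornerB c)) (2 * n) s) {r : K} (hr : 0 < r) :
    recExpQ F q (affMap (hornerA t) (hornerB c)) (2 * n) (fun y => (y - hornerVal t c n s) ^ 2) s
      ≤ (1 + r) * ((2 * ∑ i ∈ range n, (t ^ 2) ^ i) * (G ^ 2 / 4))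
        + (1 + r⁻¹) * ((2 * ∑ i ∈ range n, |t| ^ i) * (ε * G)) ^ 2 := by
  rw [← affMean_horner, ← absGainSum_horner, ← sqGainSum_horner]
  exact recExpQ_sq_le_general F hq01 hq _ _ _ s hns hgap hr

/-- **FMA-Horner's mean square under limited-randomness SR** (every `r > 0`). -/
theorem fma_sq_le_general (F : Finset K) {q : K → K} {ε G : K}
    (hq01 : ∀ η, 0 ≤ η → η ≤ 1 → 0 ≤ q η ∧ q η ≤ 1) (hq : ∀ η, 0 ≤ η → η ≤ 1 → |q η - η| ≤ ε)
    (t : K) (c : ℕ → K) (n : ℕ) (s : K) (hns : NoSatR F (affMap (fun _ => t) c) n s)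
    (hgap : GapLER F G (affMap (fun _ => t) c) n s) {r : K} (hr : 0 < r) :
    recExpQ F q (affMap (fun _ => t) c) n (fun y => (y - hornerVal t c n s) ^ 2) s
      ≤ (1 + r) * ((∑ i ∈ range n, (t ^ 2) ^ i) * (G ^ 2 / 4))
        + (1 + r⁻¹) * ((∑ i ∈ range n, |t| ^ i) * (ε * G)) ^ 2 := by
  rw [← affMean_fma, ← absGainSum_const, ← sqGainSum_const]
  exact recExpQ_sq_le_general F hq01 hq _ _ _ s hns hgap hr

/-- **Horner's RMS triangle law** over `ℝ`: `RMS(P̂ − P(t)) ≤ √(2∑t²ⁱ)·G/2 + 2(∑|t|ⁱ)·εG`. -/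
theorem horner_sq_le_rms (F : Finset ℝ) {q : ℝ → ℝ} {ε G : ℝ}
    (hq01 : ∀ η, 0 ≤ η → η ≤ 1 → 0 ≤ q η ∧ q η ≤ 1) (hq : ∀ η, 0 ≤ η → η ≤ 1 → |q η - η| ≤ ε)
    (hG : 0 ≤ G) (t : ℝ) (c : ℕ → ℝ) (n : ℕ) (s : ℝ)
    (hns : NoSatR F (affMap (hornerA t) (hornerB c)) (2 * n) s)
    (hgap : GapLER F G (affMap (hornerA t) (hornerB c)) (2 * n) s) :
    recExpQ F q (affMap (hornerA t) (hornerB c)) (2 * n) (fun y => (y - hornerVal t c n s) ^ 2) s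
      ≤ (Real.sqrt (2 * ∑ i ∈ range n, (t ^ 2) ^ i) * G / 2
          + (2 * ∑ i ∈ range n, |t| ^ i) * (ε * G)) ^ 2 := by
  rw [← affMean_horner, ← absGainSum_horner, ← sqGainSum_horner]
  exact recExpQ_sq_le_rms F hq01 hq hG _ _ _ s hns hgap

/-- **FMA-Horner's RMS triangle law** over `ℝ`: `RMS ≤ √(∑t²ⁱ)·G/2 + (∑|t|ⁱ)·εG`. -/
theorem fma_sq_le_rms (F : Finset ℝ) {q : ℝ → ℝ} {ε G : ℝ}
    (hq01 : ∀ η, 0 ≤ η → η ≤ 1 → 0 ≤ q η ∧ q η ≤ 1) (hq : ∀ η, 0 ≤ η → η ≤ 1 → |q η - η| ≤ ε)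
    (hG : 0 ≤ G) (t : ℝ) (c : ℕ → ℝ) (n : ℕ) (s : ℝ) (hns : NoSatR F (affMap (fun _ => t) c) n s)
    (hgap : GapLER F G (affMap (fun _ => t) c) n s) :
    recExpQ F q (affMap (fun _ => t) c) n (fun y => (y - hornerVal t c n s) ^ 2) s
      ≤ (Real.sqrt (∑ i ∈ range n, (t ^ 2) ^ i) * G / 2 + (∑ i ∈ range n, |t| ^ i) * (ε * G)) ^ 2 := by
  rw [← affMean_fma, ← absGainSum_const, ← sqGainSum_const]
  exact recExpQ_sq_le_rms F hq01 hq hG _ _ _ s hns hgap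

end LimitedBits

/-! ### FP4 (E2M1) kernel witnesses: `t = 3/4`, `s = 2`, `(c₀, c₁) = (3/2, −1/2)`, `P(t) = 7/4` -/

namespace FP4

open LimitedBits

/-- Witness coefficients `c₀ = 3/2`, `c₁ = −1/2` (after the leading `s = 2`). -/
def hw : ℕ → ℚ := fun j => if j = 0 then 3/2 else -1/2

/-- `P(3/4) = 2·(3/4)² + (3/2)(3/4) − 1/2 = 7/4`. -/
theorem hw_val : hornerVal (3/4 : ℚ) hw 2 2 = 7/4 := by decide +kernel

/-- Hypotheses: no branch saturates; gaps `≤ 1` (Horner, 4 roundings) and `≤ 1/2` (FMA, 2 roundings). -/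
theorem hw_hyps : NoSatR e2m1 (affMap (hornerA (3/4 : ℚ)) (hornerB hw)) 4 2 ∧
    GapLER e2m1 1 (affMap (hornerA (3/4 : ℚ)) (hornerB hw)) 4 2 ∧
    NoSatR e2m1 (affMap (fun _ => (3/4 : ℚ)) hw) 2 2 ∧
    GapLER e2m1 (1/2) (affMap (fun _ => (3/4 : ℚ)) hw) 2 2 := by
  decide +kernel

/-- **Exact SR**: both schemes have mean `P(t) = 7/4`; Horner MSE `1/4` (envelope `2(1+9/16)·1²/4 = 25/32`),
FMA MSE `1/16` (envelope `(1+9/16)·(1/2)²/4 = 25/256`). -/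
theorem hw_exact :
    recExp e2m1 (affMap (hornerA (3/4 : ℚ)) (hornerB hw)) 4 (fun y => y) 2 = 7/4 ∧
    recExp e2m1 (affMap (fun _ => (3/4 : ℚ)) hw) 2 (fun y => y) 2 = 7/4 ∧
    recExp e2m1 (affMap (hornerA (3/4 : ℚ)) (hornerB hw)) 4 (fun y => (y - 7/4) ^ 2) 2 = 1/4 ∧
    recExp e2m1 (affMap (fun _ => (3/4 : ℚ)) hw) 2 (fun y => (y - 7/4) ^ 2) 2 = 1/16 := by
  decide +kernel

/-- **One random bit, Horner**: StochasticA mean `3/2` (bias `−1/4`), StochasticB mean `2` (`+1/4`),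
StochasticC mean `3/2` (`−1/4`) — the inexact value `9/4` has residual `1/4`, which one bit cannot
represent (`⌊1/2⌋ = 0`, `⌊1/2 + 1/2⌋ = 1`, `rnite(1/2) = 0`). Envelope (`horner_bias_le`): `7/2·(1/2)·1 = 7/4`. -/
theorem hw_horner_one_bit :
    recExpQ e2m1 (probAwayA 1) (affMap (hornerA (3/4 : ℚ)) (hornerB hw)) 4 (fun y => y) 2 = 3/2 ∧
    recExpQ e2m1 (probAwayB 1) (affMap (hornerA (3/4 : ℚ)) (hornerB hw)) 4 (fun y => y) 2 = 2 ∧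
    recExpQ e2m1 (probAwayC 1) (affMap (hornerA (3/4 : ℚ)) (hornerB hw)) 4 (fun y => y) 2 = 3/2 := by
  decide +kernel

/-- **One random bit, FMA-Horner**: all three P3109 rules stay unbiased (mean `7/4`) with MSE `1/16` — the
only inexact pre-rounding value `7/4` has the dyadic residual `1/2`. -/
theorem hw_fma_one_bit :
    recExpQ e2m1 (probAwayA 1) (affMap (fun _ => (3/4 : ℚ)) hw) 2 (fun y => y) 2 = 7/4 ∧
    recExpQ e2m1 (probAwayB 1) (affMap (fun _ => (3/4 : ℚ)) hw) 2 (fun y => y) 2 = 7/4 ∧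
    recExpQ e2m1 (probAwayC 1) (affMap (fun _ => (3/4 : ℚ)) hw) 2 (fun y => y) 2 = 7/4 ∧
    recExpQ e2m1 (probAwayA 1) (affMap (fun _ => (3/4 : ℚ)) hw) 2 (fun y => (y - 7/4) ^ 2) 2 = 1/16 := by
  decide +kernel

/-- Two random bits restore unbiasedness of Horner here (all residuals are multiples of `1/4`). -/
theorem hw_horner_two_bits :
    recExpQ e2m1 (probAwayA 2) (affMap (hornerA (3/4 : ℚ)) (hornerB hw)) 4 (fun y => y) 2 = 7/4 ∧
    recExpQ e2m1 (probAwayB 2) (affMap (hornerA (3/4 : ℚ)) (hornerB hw)) 4 (fun y => y) 2 = 7/4 ∧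
    recExpQ e2m1 (probAwayC 2) (affMap (hornerA (3/4 : ℚ)) (hornerB hw)) 4 (fun y => y) 2 = 7/4 := by
  decide +kernel

/-- The general law instantiated: Horner's one-bit StochasticA bias `|3/2 − 7/4| ≤ (2·(1 + 3/4))·(1/2·1)`. -/
example : |recExpQ e2m1 (probAwayA 1) (affMap (hornerA (3/4 : ℚ)) (hornerB hw)) (2 * 2) (fun y => y) 2
      - hornerVal (3/4 : ℚ) hw 2 2| ≤ (2 * ∑ i ∈ range 2, |(3/4 : ℚ)| ^ i) * (1 / 2 ^ 1 * 1) :=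
  horner_bias_le e2m1 (probAwayA_mem 1) (fun η _ _ => abs_probAwayA_sub_le 1 η) (3/4) hw 2 2
    hw_hyps.1 hw_hyps.2.1

end FP4

end Summit.Ventures.CertifiedArithmetic.LowPrec.SR
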